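import Mathlib
import Summits.ValiantsHypothesis.ValiantsHypothesis.Theorems.DivisionGapPerMultiplesHardZSpreadPatterns
import Summits.ValiantsHypothesis.ValiantsHypothesis.Theorems.DivisionGapPerDivisionHardStubSparseRigidCount
import Literature.Computability.AlgebraicComplexity.PermanentIrreducible
import Literature.Computability.AlgebraicComplexity.MonotoneStructure

/-!
# `DivisionGap.PerCofactorDegreeReduction` (stmt-ValiantsHypothesis-15046), line `Sketch_ideator4`:
probe-rich classes (stub `stub_probeRichRung`, P)

The sibling line's `k`-cell spread engine `PerMultiplesHard.ZSpreadPatterns.zSpreadPatterns` as a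
rung of this line.  Fix a set `Z` of `k` row shifts containing `1`, `1 ≤ k`, `3k ≤ n`.  If the
cofactor `h ∈ ℝ≥0[x_ij]` is torus-homogeneous (all monomials have the same row margins `τ.1` and
column margins `τ.2`) and for EVERY permutation `π` some monomial of `h` is a `Z`-probe for `π`
(all its cells `(a, b)` have `π b = ζ a` for some `ζ ∈ Z`), then

* `g = per_n · h` is torus-homogeneous with margins `(τ.1 + 1, τ.2 + 1)`, all rows hit
  (`supp (per · h) ⊆ supp per + supp h`, permutation monomials have unit margins;
  `margins_perMul`);
* every `π` has the `Z`-probe `μ_π + m` in `supp g` (over `ℝ≥0` nothing cancels,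
  `add_mem_support_mul`; the cells `(π i, i)` of `μ_π` use the shift `1 ∈ Z`; `probe_perMul`),

so the engine's count is `n!` and `n! · 3^{⌊n/(3k²)⌋} ≤ L⁺(per_n · h) · 2^{⌊n/(3k²)⌋} · n!`.

No definitions in this file. [folklore]
-/

noncomputable section

-- `Summit.ValiantsHypothesis.ValiantsHypothesis.…` is the tree's mandated single-conjunct layout
-- (Sub = Summit), so the duplicated namespace component is intended.
set_option linter.dupNamespace false

open MvPolynomial Literature.Computability.AlgebraicComplexity
open scoped NNReal

namespace Summit.ValiantsHypothesis.ValiantsHypothesis.Theorems.DivisionGap.PerCofactorDegreeReduction.ProbeRichRung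

/-- **Margins of `per_n · h`.**  If every monomial of `h` has row margins `ρ` and column margins
`γ`, then every monomial of `per_n · h` has row margins `ρ + 1` and column margins `γ + 1`
(`supp (per · h) ⊆ supp per + supp h`, the monomials of `per` are the permutation monomials, and
these have unit margins). [folklore] -/
theorem margins_perMul {n : ℕ} {h : MvPolynomial (Fin n × Fin n) ℝ≥0} {ρ γ : Fin n →₀ ℕ}
    (hτ : ∀ m ∈ h.support, (Finsupp.mapDomain Prod.fst m, Finsupp.mapDomain Prod.snd m) = (ρ, γ)) :
    ∀ m ∈ (perPoly (Fin n) ℝ≥0 * h).support,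
      (∀ i, ∑ j, m (i, j) = ρ i + 1) ∧ (∀ j, ∑ i, m (i, j) = γ j + 1) := by
  classical
  intro m hm
  obtain ⟨u, hu, m', hm', rfl⟩ := Finset.mem_add.mp (support_mul _ _ hm)
  obtain ⟨σ, rfl⟩ := exists_permMonomial_eq_of_coeff_perPoly_ne_zero ℝ≥0 (mem_support_iff.mp hu)
  obtain ⟨h1, h2⟩ := Prod.mk.injEq _ _ _ _ ▸ hτ m' hm'
  refine ⟨fun i => ?_, fun j => ?_⟩
  · have hr : ∑ j, permMonomial σ (i, j) = 1 := rowCount_permMonomial σ i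
    have hr' : ∑ j, m' (i, j) = ρ i := by
      rw [← h1]
      exact (Summit.ValiantsHypothesis.ValiantsHypothesis.Theorems.DivisionGapPerDivisionHard.rowDegrees_apply
        m' i).symm
    simp only [Finsupp.coe_add, Pi.add_apply, Finset.sum_add_distrib, hr, hr']
    omega
  · have hc : ∑ i, permMonomial σ (i, j) = 1 := colCount_permMonomial σ j
    have hc' : ∑ i, m' (i, j) = γ j := by
      rw [← h2]
      exact (Summit.ValiantsHypothesis.ValiantsHypothesis.Theorems.DivisionGapPerDivisionHard.colDegrees_apply
        m' j).symm
    simp only [Finsupp.coe_add, Pi.add_apply, Finset.sum_add_distrib, hc, hc']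
    omega

/-- **Probes of `per_n · h`.**  If `1 ∈ Z` and `m ∈ supp h` is a `Z`-probe for `π` (every cell
`(a, b)` of `m` has `π b = ζ a` for some `ζ ∈ Z`), then `μ_π + m ∈ supp (per_n · h)` is a
`Z`-probe for `π` as well: over `ℝ≥0` nothing cancels (`add_mem_support_mul`), and the cells
`(π i, i)` of `μ_π` use the shift `1 ∈ Z`. [folklore] -/
theorem probe_perMul {n : ℕ} {Z : Finset (Equiv.Perm (Fin n))} (h1Z : (1 : Equiv.Perm (Fin n)) ∈ Z)
    {h : MvPolynomial (Fin n × Fin n) ℝ≥0} (π : Equiv.Perm (Fin n)) {m : (Fin n × Fin n) →₀ ℕ}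
    (hm : m ∈ h.support) (hpm : ∀ e ∈ m.support, ∃ ζ ∈ Z, π e.2 = ζ e.1) :
    permMonomial π + m ∈ (perPoly (Fin n) ℝ≥0 * h).support ∧
      ∀ e ∈ (permMonomial π + m).support, ∃ ζ ∈ Z, π e.2 = ζ e.1 := by
  classical
  refine ⟨add_mem_support_mul ?_ hm, fun e he => ?_⟩
  · rw [mem_support_iff, coeff_permMonomial_perPoly]
    exact one_ne_zero
  · rcases Finset.mem_union.mp (Finsupp.support_add he) with he1 | he2
    · refine ⟨1, h1Z, ?_⟩
      obtain ⟨r, c⟩ := e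
      have hne := Finsupp.mem_support_iff.mp he1
      rw [permMonomial_apply] at hne
      rw [Equiv.Perm.one_apply]
      by_contra hrc
      exact hne (if_neg hrc)
    · exact hpm e he2

/-- **Stub P (probe-rich classes) of line `Sketch_ideator4`: the sibling line's `k`-cell spread
engine `PerMultiplesHard.ZSpreadPatterns.zSpreadPatterns` as a rung of this line.**  Fix a set `Z`
of `k` row shifts containing `1`.  If `h` is torus-homogeneous and for EVERY permutation `π` some
monomial of `h` is a `Z`-probe for `π` (all its cells `(a, b)` have `π b = ζ a` for some `ζ ∈ Z`),
then `per_n · h` is torus-homogeneous with all rows hit (`margins_perMul`) and EVERY `π` has the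
`Z`-probe `μ_π + m` in `supp (per_n · h)` (`probe_perMul`), so the engine's count is `n!` and
`n! · 3^{⌊n/(3k²)⌋} ≤ L⁺(per_n · h) · 2^{⌊n/(3k²)⌋} · n!`. [folklore] -/
theorem stub_probeRichRung :
    ∀ (n k : ℕ) (Z : Finset (Equiv.Perm (Fin n))), Z.card = k → 1 ≤ k → 3 * k ≤ n →
      (1 : Equiv.Perm (Fin n)) ∈ Z →
      ∀ h : MvPolynomial (Fin n × Fin n) ℝ≥0,
        (∃ τ : (Fin n →₀ ℕ) × (Fin n →₀ ℕ),
          ∀ m ∈ h.support, (Finsupp.mapDomain Prod.fst m, Finsupp.mapDomain Prod.snd m) = τ) →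
        (∀ π : Equiv.Perm (Fin n), ∃ m ∈ h.support, ∀ e ∈ m.support, ∃ ζ ∈ Z, π e.2 = ζ e.1) →
        Nat.factorial n * 3 ^ (n / (3 * k ^ 2)) ≤
          complexity (perPoly (Fin n) ℝ≥0 * h) * (2 ^ (n / (3 * k ^ 2)) * Nat.factorial n) := by
  classical
  intro n k Z hZ hk hkn h1Z h hτ hprobe
  obtain ⟨⟨ρ, γ⟩, hτ⟩ := hτ
  have hall : ∀ π ∈ (Finset.univ : Finset (Equiv.Perm (Fin n))),
      ∃ m ∈ (perPoly (Fin n) ℝ≥0 * h).support, ∀ e ∈ m.support, ∃ ζ ∈ Z, π e.2 = ζ e.1 := by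
    intro π _
    obtain ⟨m, hm, hpm⟩ := hprobe π
    obtain ⟨hmem, hpr⟩ := probe_perMul h1Z π hm hpm
    exact ⟨_, hmem, hpr⟩
  have heng :=
    Summit.ValiantsHypothesis.ValiantsHypothesis.Theorems.DivisionGap.PerMultiplesHard.ZSpreadPatterns.zSpreadPatterns
      n k Z hZ hk hkn (perPoly (Fin n) ℝ≥0 * h) (fun i => ρ i + 1) (fun j => γ j + 1)
      (margins_perMul hτ) (fun i => Nat.succ_ne_zero _)
  rw [Finset.filter_true_of_mem hall, Finset.card_univ, Fintype.card_perm, Fintype.card_fin] at heng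
  exact heng

end Summit.ValiantsHypothesis.ValiantsHypothesis.Theorems.DivisionGap.PerCofactorDegreeReduction.ProbeRichRung

end
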